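import Summits.KontsevichZagierPeriods.KontsevichZagierPeriods.Theses.OctahedralSymmetry
import Literature.NumberTheory.Transcendental.CyclotomicSimplexRep
import Literature.NumberTheory.Transcendental.KZProductIdeal

/-!
# `ZhaoRelationInKZ` (stmt-KontsevichZagierPeriods-9433, route `OctahedralSymmetry`) — line `Sketch`:
the word-certificate vocabulary (definitions only)

Zhao's non-standard weight-3 level-4 relation [Zhao 2010, arXiv:0707.1459, Rem. 10.1] is proved
inside the Kontsevich–Zagier calculus as an explicit `ℚ`-certificate over three REGULARISATION-FREE
engines (exact linear algebra of the line, file `work/num/` of the lead session: the 160 symbols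
`Re I(W)`, `Im I(W)` of the 80 convergent weight-3 words; families {octahedral involution `σ` at
weight 3, the weight-2 distribution `t ↦ t²` lifted by a weight-1 letter, the finite double
shuffle block (1)×(1,1)} have rank 150 of 152 and contain both parts of Zhao's combination;
a sparse certificate uses 20 σ-, 6 lifted-dilation- and 10 stuffle-instances with denominators
dividing 12). This file fixes the VOCABULARY of the certificate, and nothing else:

* `repRe W h`, `repIm W h` — the canonical rational simplex representations of `Re I(W)`,
  `Im I(W)` (`KZ.levelFourRepRe/Im` of `CyclotomicSimplexRep.lean` fed with absolute convergence
  of convergent words), `rep b W h` (`b = false/true` for Re/Im);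
* `Z b W : KZ.FormalRep` — the CLASS of `rep b W` when `W` is convergent, `0` otherwise (total,
  so that engine statements can sum over symbolic expansions); `ZP b b' U V` — the class of the
  Fubini product `(rep b U).prod (rep b' V)` (both convergent), `0` otherwise;
* symbols `Sym = Bool × List (Fin 5)`, rows `Row = List (Sym × ℤ)` and their evaluation
  `evalRow ρ = Σ c • Z b W`; `Row.re/Row.im` of a term list `List (ℤ × List (Fin 5))`;
* the COMPUTABLE term lists of the three engines and of the free conjugation rows:
  `sigmaTerms` (via `LevelFour.expand LevelFour.sigmaLetter`), `dilLiftTerms` (via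
  `LevelFour.expand LevelFour.dilLetter` and the three interleavings `shuffle12`), `fdsTerms`
  (the five stuffle words minus the three shuffle words of `Li₁ · Li_{1,1}`), `conjTermsRe/Im`,
  `imZeroTerms`, `zhaoTerms` (the crux's nine words and coefficients);
* the COMPUTABLE certificate checker `certCheck X rows N T` (bucket-collect the difference
  `Σⱼ Xⱼ ρⱼ − N·T` and test that every coefficient vanishes), decided by `decide` in the closing
  file; its soundness (`evalRow`-linearity) is proved in the companion proof files.

Letters are those of `CyclotomicSimplexRep.lean`: `m ≤ 3` is the pole `i^m`, `4` the pole `0`;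
words `List (Fin 5)` are read outer → inner on `1 > t₀ > t₁ > t₂ > 0`.

References: J. Zhao, Doc. Math. 15 (2010) 1–34 (arXiv:0707.1459), Rem. 10.1, §2 (FDS), §5;
J. Zhao, C. R. Acad. Sci. Paris 346 (2008) (arXiv:0810.1064), §4 (the involution `σ`);
M. Kontsevich, D. Zagier, *Periods* (2001), §1.2.
-/

namespace Summit.KontsevichZagierPeriods.OctahedralSymmetry.ZhaoRelationInKZ

open Literature.NumberTheory.Transcendental

/-! ## Part I. Computable data: symbols, rows, term lists, the certificate checker -/

/-- A symbol: `(false, W)` stands for `Re I(W)`, `(true, W)` for `Im I(W)`. [folklore] -/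
abbrev Sym : Type := Bool × List (Fin 5)

/-- A row: a formal `ℤ`-combination of symbols, as an association list (repetitions allowed,
coefficients add up under `evalRow`). [folklore] -/
abbrev Row : Type := List (Sym × ℤ)

/-- The real-part row of a term list `Σ c·[W]`: every word read as the symbol `Re I(W)`.
[folklore] -/
def Row.re (L : List (ℤ × List (Fin 5))) : Row := L.map fun p => ((false, p.2), p.1)

/-- The imaginary-part row of a term list: every word read as the symbol `Im I(W)`. [folklore] -/
def Row.im (L : List (ℤ × List (Fin 5))) : Row := L.map fun p => ((true, p.2), p.1)

/-- **σ-terms** of a word `W` (the octahedral involution relation, Zhao 2008 §4):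
`[W] + Σ_{(c,V) ∈ expand σ W} c·[reverse V]`, which evaluates to `0` on `I(·)` for convergent `W`
of odd length (`I(W) = (-1)^{|W|} Σ c I(reverse V)`; here `|W| = 3`). [cite: Zhao2008, §4] -/
def sigmaTerms (W : List (Fin 5)) : List (ℤ × List (Fin 5)) :=
  (1, W) :: (LevelFour.expand LevelFour.sigmaLetter W).map fun cV => (cV.1, cV.2.reverse)

/-- The three interleavings `a ш (v₀ v₁) = (a v₀ v₁) + (v₀ a v₁) + (v₀ v₁ a)` of a letter into a
two-letter word (junk `[]` on words of other lengths). [cite: Zhao2010, §2 Lemma 2.2] -/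
def shuffle12 (a : Fin 5) : List (Fin 5) → List (List (Fin 5))
  | [v₀, v₁] => [[a, v₀, v₁], [v₀, a, v₁], [v₀, v₁, a]]
  | _ => []

/-- **Lifted-dilation terms**: the weight-2 distribution relation
`[U] − Σ_{(c,V) ∈ expand dil U} c·[V]` (`t ↦ t²` on the ordered 2-simplex, Zhao 2010 §5) multiplied
by the letter `a` and expanded by the shuffle `a ш ·`. [cite: Zhao2010, §5] -/
def dilLiftTerms (a : Fin 5) (U : List (Fin 5)) : List (ℤ × List (Fin 5)) :=
  ((shuffle12 a U).map fun W => ((1 : ℤ), W)) ++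
    (LevelFour.expand LevelFour.dilLetter U).flatMap fun cV =>
      (shuffle12 a cV.2).map fun W => (-cV.1, W)

/-- **Finite-double-shuffle terms, block (1)×(1,1)**: for poles `p = i^x`, `q = i^y`,
`r = i^{y+z}` the stuffle expansion of `I(p)·I(q,r)` (three depth-3 words `(p,pq,pr)`, `(q,pq,pr)`,
`(q,r,pr)` and, with sign `−`, the two merged words `(0,pq,pr)`, `(q,0,pr)`; Zhao 2010 Def. 2.4 read
through `Li = (-1)^ℓ I`) MINUS its shuffle expansion `(p,q,r) + (q,p,r) + (q,r,p)`.
[cite: Zhao2010, §2 (FDS)] -/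
def fdsTerms (x y z : Fin 4) : List (ℤ × List (Fin 5)) :=
  [(1, [Fin.castSucc x, Fin.castSucc (x + y), Fin.castSucc (x + y + z)]),
    (1, [Fin.castSucc y, Fin.castSucc (x + y), Fin.castSucc (x + y + z)]),
    (1, [Fin.castSucc y, Fin.castSucc (y + z), Fin.castSucc (x + y + z)]),
    (-1, [4, Fin.castSucc (x + y), Fin.castSucc (x + y + z)]),
    (-1, [Fin.castSucc y, 4, Fin.castSucc (x + y + z)]),
    (-1, [Fin.castSucc x, Fin.castSucc y, Fin.castSucc (y + z)]),
    (-1, [Fin.castSucc y, Fin.castSucc x, Fin.castSucc (y + z)]),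
    (-1, [Fin.castSucc y, Fin.castSucc (y + z), Fin.castSucc x])]

/-- Conjugation terms, real part: `[conj W] − [W]` (`Re I(W̄) = Re I(W)`). [folklore] -/
def conjTermsRe (W : List (Fin 5)) : List (ℤ × List (Fin 5)) := [(1, LevelFour.conjWord W), (-1, W)]

/-- Conjugation terms, imaginary part: `[conj W] + [W]` (`Im I(W̄) = −Im I(W)`). [folklore] -/
def conjTermsIm (W : List (Fin 5)) : List (ℤ × List (Fin 5)) := [(1, LevelFour.conjWord W), (1, W)]

/-- The single term `[W]` (used for `Im I(W) = 0` when `W` is self-conjugate). [folklore] -/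
def imZeroTerms (W : List (Fin 5)) : List (ℤ × List (Fin 5)) := [(1, W)]

/-- **Zhao's combination**: the nine words (outer → inner) and coefficients of the crux
`ZhaoRelationInKZ`, `c = (−5,−46,7,13,13,1,−25,8,18)` on
`(−1,0,−i), (−i,−i,−i), (−1,1,−i), (−i,−1,i), (i,0,1), (i,−i,−i), (i,i,i), (−i,−1,1), (0,i,i)`.
[cite: Zhao2010, Rem. 10.1] -/
def zhaoTerms : List (ℤ × List (Fin 5)) :=
  [(-5, [2, 4, 3]), (-46, [3, 3, 3]), (7, [2, 0, 3]), (13, [3, 2, 1]), (13, [1, 4, 0]),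
    (1, [1, 3, 3]), (-25, [1, 1, 1]), (8, [3, 2, 0]), (18, [4, 1, 1])]

/-- Add `c` to the coefficient of the symbol `s` in a bucket list (new bucket at the end if `s` is
absent). [folklore] -/
def addTo : Row → Sym → ℤ → Row
  | [], s, c => [(s, c)]
  | (s', c') :: acc, s, c => if s' = s then (s', c' + c) :: acc else (s', c') :: addTo acc s c

/-- Collect a row into buckets, one per occurring symbol. [folklore] -/
def collect : Row → Row
  | [] => []
  | (s, c) :: ρ => addTo (collect ρ) s c

/-- A row is (syntactically certified) zero if every bucket of `collect` carries coefficient `0`.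
[folklore] -/
def isZeroRow (ρ : Row) : Bool := (collect ρ).all fun p => p.2 == 0

/-- Scale a row by an integer. [folklore] -/
def scaleRow (N : ℤ) (ρ : Row) : Row := ρ.map fun p => (p.1, N * p.2)

/-- The integer linear combination `Σⱼ Xⱼ ρⱼ` of rows (truncated to the shorter list). [folklore] -/
def lincomb : List ℤ → List Row → Row
  | x :: xs, ρ :: ρs => scaleRow x ρ ++ lincomb xs ρs
  | _, _ => []

/-- **The certificate checker**: `Σⱼ Xⱼ ρⱼ − N·T` collects to the zero row. Soundness
(`certCheck X rows N T = true → (∀ ρ ∈ rows, evalRow ρ ∈ KZ.relations) → N • evalRow T ∈ KZ.relations`)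
is proved in the companion proof file. [folklore] -/
def certCheck (X : List ℤ) (rows : List Row) (N : ℤ) (T : Row) : Bool :=
  isZeroRow (lincomb X rows ++ scaleRow (-N) T)

/-! ## Part II. The representations and the evaluation of rows -/

noncomputable section

open Literature.NumberTheory.Transcendental.KZ

/-- **`repRe W h`**: the canonical rational simplex representation of `Re I(W)` for a convergent
word `W` — domain the open ordered simplex `KZ.openOrderedSimplex |W|`, integrand
`KZ.levelFourIntegrandRe W`, absolutely convergent by `KZ.integrableOn_levelFourIntegrandC h`.
[cite: KontsevichZagier2001, §1.1] -/
def repRe (W : List (Fin 5)) (h : LevelFour.IsConvergent W) : IntegralRep W.length :=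
  levelFourRepRe W (integrableOn_levelFourIntegrandC h)

/-- **`repIm W h`**: the canonical rational simplex representation of `Im I(W)`.
[cite: KontsevichZagier2001, §1.1] -/
def repIm (W : List (Fin 5)) (h : LevelFour.IsConvergent W) : IntegralRep W.length :=
  levelFourRepIm W (integrableOn_levelFourIntegrandC h)

/-- `rep false = repRe`, `rep true = repIm`. [folklore] -/
def rep (b : Bool) (W : List (Fin 5)) (h : LevelFour.IsConvergent W) : IntegralRep W.length :=
  bif b then repIm W h else repRe W h

/-- **`Z b W`**: the class in `KZ.FormalRep` of the canonical representation of `Re I(W)`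
(`b = false`) / `Im I(W)` (`b = true`) if `W` is convergent, and `0` otherwise. [folklore] -/
def Z (b : Bool) (W : List (Fin 5)) : FormalRep :=
  if h : LevelFour.IsConvergent W then of (rep b W h) else 0

/-- **`ZP b b' U V`**: the class of the Fubini product `(rep b U).prod (rep b' V)` (domain
`Δ_{|U|} × Δ_{|V|}`, integrand the product) if both words are convergent, `0` otherwise; by
`KZ.of_mul_of` it is `Z b U * Z b' V`. [cite: KontsevichZagier2001, §4.1] -/
def ZP (b b' : Bool) (U V : List (Fin 5)) : FormalRep :=
  if h : LevelFour.IsConvergent U ∧ LevelFour.IsConvergent V then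
    of ((rep b U h.1).prod (rep b' V h.2)) else 0

/-- **Evaluation of a row**: `evalRow ρ = Σ_{((b,W),c) ∈ ρ} c • Z b W`. [folklore] -/
def evalRow (ρ : Row) : FormalRep := (ρ.map fun p => p.2 • Z p.1.1 p.1.2).sum

end

end Summit.KontsevichZagierPeriods.OctahedralSymmetry.ZhaoRelationInKZ
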